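import Mathlib
import HarnessLib
import Literature.Analysis.FluidPDE.StretchingRate
import Literature.Analysis.FluidPDE.ClassicalSolutionCalculus
import Summits.NavierStokesRegularity.NavierStokesRegularity.Theorems.AdaptedFrequencyEnstrophyDensity
import Summits.NavierStokesRegularity.NavierStokesRegularity.Theorems.IsobarTomographyBlobRiccatiClosureStubContinuation
import Summits.NavierStokesRegularity.NavierStokesRegularity.Theorems.IsobarTomographyBlobRiccatiClosureStubPeakGrowth
import Summits.NavierStokesRegularity.NavierStokesRegularity.Theorems.IsobarTomographyBlobRiccatiClosureStubUniformDecay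
import Summits.NavierStokesRegularity.NavierStokesRegularity.Theorems.IsobarTomographyBlobRiccatiClosureStubSupGronwall

/-!
# Crux `IsobarTomography.BlobRiccatiClosure` (stmt-NavierStokesRegularity-11740), line `Sketch`:
# the PEAK-STRETCHING CONTINUATION CRITERION (S1 + S3 + S4a + S4b assembled; PROVED)

The closed-form reduction of the line: a classical solution of unforced Navier–Stokes on `ℝ³ × [0, T)`,
Leray–Hopf from its rapidly decaying datum, whose stretching rate `α = ⟪ξ, ∇u ξ⟫` at every spatial maximum of
`‖curl u(t,·)‖²` (with non-zero vorticity there) is majorised on some late interval `[t₁, T)` by a continuous `g`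
with `∫_{t₁}^t g ≤ I` uniformly, extends classically past `T`. This is the peak-localised form of
"d⁺/dt ‖ω‖_∞ ≤ α(x⋆) ‖ω‖_∞ plus Beale–Kato–Majda" (Majda–Bertozzi 2002, §5.1 (5.8)–(5.12); Constantin–Fefferman
1993, §1), made unconditional from theorems of the tree: the landed stubs `stub_peakGrowth` (S3),
`stub_uniformDecay` (S4a), `stub_supGronwall` (S4b), `stub_continuation` (S1) of this line. With it the crux is
EQUIVALENT to its residual stub S6 (`stub_peakStretchingBound`: the blob hypothesis delivers such a `g`).

References: A. J. Majda, A. L. Bertozzi, *Vorticity and Incompressible Flow* (2002), §5.1; P. Constantin,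
C. Fefferman, Indiana Univ. Math. J. 42 (1993), §1; J. T. Beale, T. Kato, A. Majda, Comm. Math. Phys. 94 (1984).
-/

noncomputable section

open MeasureTheory Set Function Filter Topology
open scoped ENNReal NNReal InnerProductSpace RealInnerProductSpace

-- the summit and its single sub-problem share the name (CONVENTIONS §1), as in every Theorems file
set_option linter.dupNamespace false

namespace Summit.NavierStokesRegularity.NavierStokesRegularity.Theorems.BlobRiccatiClosure.Sketch

open Literature.Analysis Literature.Analysis.FluidPDE
open Summit.NavierStokesRegularity.NavierStokesRegularity.Theorems

local notation "E³" => EuclideanSpace ℝ (Fin 3)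

/-- **PEAK-STRETCHING CONTINUATION CRITERION** (the line's reduction in closed form). Let `(u, p)` be a
classical solution of unforced Navier–Stokes on `ℝ³ × [0, T)`, Leray–Hopf from its rapidly decaying datum, and
suppose that on some `[t₁, T)`, `0 ≤ t₁ < T`, the stretching rate at every spatial maximum `x⋆` of
`‖curl u(t,·)‖²` with `curl u(t,x⋆) ≠ 0` is bounded by `g(t)`, `g` continuous on `[t₁, T)` with
`∫_{t₁}^t g ≤ I` for all `t`. Then the solution extends classically past `T`. (Peak-localised form of
"d⁺/dt ‖ω‖_∞ ≤ α(x⋆)‖ω‖_∞ + Beale–Kato–Majda", Majda–Bertozzi §5.1 (5.8)–(5.12), Constantin–Fefferman 1993 §1: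
S3 gives `∂ₜ‖ω‖² ≤ 2g‖ω‖²` at positive maxima, S4a the hypotheses of the sup-Grönwall lemma S4b for
`f = ‖curl u‖²` on `[t₁, T)`, S4b the bound `‖ω‖² ≤ (sup‖ω(t₁,·)‖²) e^{2I}`, S1 the extension.) -/
theorem peakStretching_continuation :
    ∀ (ν T t₁ : ℝ) (u : ℝ → E³ → E³) (p : ℝ → E³ → ℝ) (g : ℝ → ℝ), 0 < ν → 0 < T → t₁ ∈ Ico 0 T →
      IsClassicalNSSolutionOn (Ico 0 T) ν 0 u p → IsLerayHopfOn T ν 0 (u 0) u →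
      HasRapidSpatialDecay (u 0) →
      ContinuousOn g (Ico t₁ T) → (∃ I : ℝ, ∀ t ∈ Ico t₁ T, ∫ s in t₁..t, g s ≤ I) →
      (∀ t ∈ Ico t₁ T, ∀ x : E³, IsMaxOn (fun y => ‖curl (u t) y‖ ^ 2) univ x →
          curl (u t) x ≠ 0 → stretchingRate (u t) x ≤ g t) →
      HasSmoothExtensionPast ν 0 u T := by
  intro ν T t₁ u p g hν hT ht₁0 hsol hLH hdec hgc hI hgα
  obtain ⟨I, hI⟩ := hI
  -- the squared vorticity and its one-sided time derivative
  set f : ℝ → E³ → ℝ := fun t x => ‖curl (u t) x‖ ^ 2 with hf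
  set f' : ℝ → E³ → ℝ := fun t x => timeDerivWithin (Ico 0 T) (fun s y => ‖curl (u s) y‖ ^ 2) t x
    with hf'
  have hS : UniqueDiffOn ℝ (Ico 0 T) := uniqueDiffOn_Ico 0 T
  have hωs : IsSmoothSpaceTimeOn (Ico 0 T) (vorticity u) :=
    isSmoothSpaceTimeOn_vorticity_of_classical hsol hS
  have hfs : IsSmoothSpaceTimeOn (Ico 0 T) f := by
    have h1 := ContDiffOn.norm_sq ℝ hωs
    unfold IsSmoothSpaceTimeOn
    refine h1.congr fun z _ => ?_
    obtain ⟨t, x⟩ := z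
    simp [hf, vorticity]
  have hf's : IsSmoothSpaceTimeOn (Ico 0 T) f' := by
    have h1 := hfs.timeDerivWithin hS
    unfold IsSmoothSpaceTimeOn at h1 ⊢
    refine h1.congr fun z _ => ?_
    obtain ⟨t, x⟩ := z
    simp [hf', hf]
  have hsub : Ico t₁ T ⊆ Ico 0 T := fun t ht => ⟨ht₁0.1.trans ht.1, ht.2⟩
  have hprod : Ico t₁ T ×ˢ (univ : Set E³) ⊆ Ico 0 T ×ˢ univ := prod_mono hsub Subset.rfl
  have hcont : ContinuousOn (uncurry f) (Ico t₁ T ×ˢ univ) := hfs.continuousOn.mono hprod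
  have hcont' : ContinuousOn (uncurry f') (Ico t₁ T ×ˢ univ) := hf's.continuousOn.mono hprod
  have hderiv : ∀ t ∈ Ico t₁ T, ∀ x : E³,
      HasDerivWithinAt (fun s => f s x) (f' t x) (Ico t₁ T) t := by
    intro t ht x
    have h1 : HasDerivWithinAt (fun s => f s x) (timeDerivWithin (Ico 0 T) f t x) (Ico 0 T) t :=
      hfs.hasDerivWithinAt_timeDerivWithin hS (hsub ht) x
    have : timeDerivWithin (Ico 0 T) f t x = f' t x := by simp [hf', hf]
    rw [← this]
    exact h1.mono hsub
  have hnonneg : ∀ t ∈ Ico t₁ T, ∀ x : E³, 0 ≤ f t x := fun t _ x => sq_nonneg _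
  -- S4a: derivative bound and uniform decay on `[0, t₂] ⊇ [t₁, t₂]`
  have hS4a := stub_uniformDecay ν T u p hν hT hsol hLH hdec
  have hbound : ∀ t₂ ∈ Ico t₁ T, ∃ B : ℝ, ∀ t ∈ Icc t₁ t₂, ∀ x : E³, |f' t x| ≤ B := by
    intro t₂ ht₂
    obtain ⟨⟨B, hB⟩, -⟩ := hS4a t₂ ht₂.2
    exact ⟨B, fun t ht x => hB t ⟨ht₁0.1.trans ht.1, ht.2⟩ x⟩
  have hdecay : ∀ t₂ ∈ Ico t₁ T, ∀ ε : ℝ, 0 < ε → ∃ R : ℝ, ∀ t ∈ Icc t₁ t₂, ∀ x : E³,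
      R ≤ ‖x‖ → f t x ≤ ε := by
    intro t₂ ht₂ ε hε
    obtain ⟨-, hR⟩ := hS4a t₂ ht₂.2
    obtain ⟨R, hR⟩ := hR ε hε
    exact ⟨R, fun t ht x hx => hR t ⟨ht₁0.1.trans ht.1, ht.2⟩ x hx⟩
  -- S3 + the hypothesis: the peak inequality with rate `2 g`
  have hg2c : ContinuousOn (fun t => 2 * g t) (Ico t₁ T) := continuousOn_const.mul hgc
  have hpeak : ∀ t ∈ Ico t₁ T, ∀ x : E³, IsMaxOn (f t) univ x → 0 < f t x →
      f' t x ≤ (2 * g t) * f t x := by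
    intro t ht x hmax hpos
    have hne : curl (u t) x ≠ 0 := by
      intro h0
      simp [hf, h0] at hpos
    have h3 := stub_peakGrowth ν T u p hν.le hT hsol t (hsub ht) x hmax
    have h6 := hgα t ht x hmax hne
    have hsq : 0 ≤ ‖curl (u t) x‖ ^ 2 := sq_nonneg _
    calc f' t x ≤ 2 * (‖curl (u t) x‖ ^ 2 * stretchingRate (u t) x) := h3
      _ ≤ 2 * (‖curl (u t) x‖ ^ 2 * g t) := by gcongr
      _ = (2 * g t) * f t x := by simp [hf]; ring
  -- S4b: the sup-Grönwall bound on `[t₁, T)`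
  have hG := stub_supGronwall t₁ T f f' (fun t => 2 * g t) ht₁0.2 hcont hcont' hderiv hnonneg hbound
    hdecay hg2c hpeak
  -- the uniform bound `B⋆ = (sup f(t₁,·)) e^{2I}`
  set M₀ : ℝ := ⨆ y, f t₁ y with hM₀
  have hM₀nn : 0 ≤ M₀ := Real.iSup_nonneg fun y => sq_nonneg _
  have hB : ∀ t ∈ Ico t₁ T, ∀ x : E³, ‖curl (u t) x‖ ^ 2 ≤ M₀ * Real.exp (2 * I) := by
    intro t ht x
    have h1 := hG t ht x
    have h2 : ∫ s in t₁..t, 2 * g s ≤ 2 * I := by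
      rw [intervalIntegral.integral_const_mul]
      linarith [hI t ht]
    calc ‖curl (u t) x‖ ^ 2 = f t x := rfl
      _ ≤ M₀ * Real.exp (∫ s in t₁..t, 2 * g s) := h1
      _ ≤ M₀ * Real.exp (2 * I) := by gcongr
  -- S1: continuation
  exact stub_continuation ν T t₁ (M₀ * Real.exp (2 * I)) u p hν hT ht₁0.2 hsol hLH hdec hB

end Summit.NavierStokesRegularity.NavierStokesRegularity.Theorems.BlobRiccatiClosure.Sketch

end
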